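import Summits.CriticalPhenomena.PercolationContinuityZ3.Theorems.PercNearOneGluingNoHeavyLowerTailEdgeContractionPrelim
import HarnessLib

/-!
# Contraction of a sure pair, realised on the same vertex type ("fold `v` into `u`")

Support file for crux `stmt-CriticalPhenomena-4575` (`NoHeavyLowerTail`), seat `prim-facecert` gen 20
(`--supports stmt-CriticalPhenomena-4575`; all-graphs `(Q6)_port`/`(C½)` programme, paper proof prim-l12-p1 gen 22, memo
`run/shared/lean/prim/prim-l12/FROM-prim-l12-p1-g22-CHALF-ALL-GRAPHS.md` §8).  No definitions, no sorries, standard axioms.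

Edge-contraction inductions for Bernoulli percolation (`μ = prodBernoulli w` on `BondConfig V = Set (Sym2 V)`, arbitrary pair
weights on a finite vertex type) want the law of the graph `G/e` with a pair `e = {u,v}` contracted.  Here the contraction is
realised WITHOUT quotient types: when `w s(u,v) = 1` the two endpoints are almost surely one cluster, and the weight function
obtained by transferring the pairs at `v` to `u` — `s(u,x) ↦ 1 − (1 − w s(u,x))(1 − w s(v,x))` (two parallel pairs = one pair) — and
then giving weight `0` to every pair at `v`, has the same law of the open-connectivity relation among the vertices other than `v`
(**`exists_fold`**, stated existentially, built from the transfer/removal rules of `…EdgeContractionPrelim`).  `exists_fold` also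
records that if all pairs other than `s(u,v)` have weight `< 1` then all folded weights are `< 1`, and that the set of vertices lying
on a pair of positive weight loses `v` (the induction measure of `…ThreePointIsoSexticAllGraphs`).
[cite: Grimmett1999, §1.6 (contraction/deletion of edges), §2.2 (events depending on finitely many edges)]
-/

noncomputable section

namespace Summit.CriticalPhenomena.PercolationContinuityZ3.Theorems.EdgeContraction

open MeasureTheory Set
open Literature.Probability.Percolation Literature.Probability.Percolation.BHK2006
open Literature.Probability.LatticeModels (prodBernoulli)
open Summit.CriticalPhenomena.PercolationContinuityZ3.Theorems.ProdWeightPivot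
open scoped Classical

/-! ## The fold at the level of `prodBernoulli` -/

section Fold

variable {V : Type*} [Fintype V]

/-- **Contraction of a sure pair, realised on the same vertex type.**  Let `w s(u,v) = 1`, `u ≠ v`.  There is a weight
function `w'` ("fold `v` into `u`": `w' s(u,x) = 1 - (1 - w s(u,x))(1 - w s(v,x))` for `x ∉ {u,v}`, every pair at `v`
gets weight `0`, all other pairs unchanged) such that (i) every event that reads the open-connectivity relation only between
vertices other than `v` has the same probability under `prodBernoulli w` and `prodBernoulli w'`; (ii) if all pairs other than
`s(u,v)` have weight `< 1` then ALL pairs have `w'`-weight `< 1`; (iii) a vertex lying on a pair of positive `w'`-weight is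
not `v` and lies on a pair of positive `w`-weight.  (So `w'` has strictly fewer non-isolated vertices: `v` is lost.)
This replaces the quotient graph `G/e` in edge-contraction inductions. [folklore; Grimmett 1999 §1.6 (contraction is again a percolation model)] -/
theorem exists_fold (w : Sym2 V → unitInterval) {u v : V} (huv : u ≠ v) (h1 : (w s(u, v) : ℝ) = 1) :
    ∃ w' : Sym2 V → unitInterval,
      (∀ P : (V → V → Prop) → Prop,
        (∀ R R' : V → V → Prop, (∀ y z, y ≠ v → z ≠ v → (R y z ↔ R' y z)) → (P R ↔ P R')) →
          (prodBernoulli w).real {ω | P fun y z => (openGraph ω).Reachable y z} =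
            (prodBernoulli w').real {ω | P fun y z => (openGraph ω).Reachable y z}) ∧
      ((∀ e, e ≠ s(u, v) → (w e : ℝ) < 1) → ∀ e, (w' e : ℝ) < 1) ∧
      (∀ y, (∃ e, y ∈ e ∧ 0 < (w' e : ℝ)) → y ≠ v ∧ ∃ e, y ∈ e ∧ 0 < (w e : ℝ)) := by
  set l : List V := (Finset.univ.filter fun x => x ≠ u ∧ x ≠ v).toList with hl
  have hlmem : ∀ x ∈ l, x ≠ u ∧ x ≠ v := fun x hx => by simpa [hl] using hx
  have hlmem' : ∀ x, x ≠ u → x ≠ v → x ∈ l := fun x h1 h2 => by simp [hl, h1, h2]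
  set wR : Sym2 V → ℝ := fun e => (w e : ℝ) with hwR
  have hw01 : ∀ e, 0 ≤ wR e ∧ wR e ≤ 1 := fun e => ⟨(w e).2.1, (w e).2.2⟩
  set W := l.foldl (fun w x => Function.update (Function.update w s(v, x) 0) s(u, x)
      (1 - (1 - w s(u, x)) * (1 - w s(v, x)))) wR with hW
  obtain ⟨P1, P2, P3, P4, P5, P6⟩ := transfer_props u v huv l hlmem wR hw01
  set L : List (Sym2 V) := (Finset.univ.filter fun e : Sym2 V => v ∈ e).toList with hL
  have hLmem : ∀ e, e ∈ L ↔ v ∈ e := fun e => by simp [hL]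
  set W' : Sym2 V → ℝ := fun e => if e ∈ L then 0 else W e with hW'
  have hW'01 : ∀ e, 0 ≤ W' e ∧ W' e ≤ 1 := fun e => by
    by_cases he : e ∈ L <;> simp only [hW', he, if_true, if_false]
    · exact ⟨le_rfl, zero_le_one⟩
    · exact P1 e
  refine ⟨fun e => ⟨W' e, (hW'01 e).1, (hW'01 e).2⟩, ?_, ?_, ?_⟩
  · -- (i) the law of connectivity away from `v`
    intro P hP
    rw [real_eq_sum_weight w MeasurableSet.of_discrete, real_eq_sum_weight _ MeasurableSet.of_discrete]
    set g : BondConfig V → ℝ := fun ω => if P (fun y z => (openGraph ω).Reachable y z) then 1 else 0 with hg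
    -- the indicator written with whatever decidability instance the summation lemma carries
    have hgdef : ∀ (ω : BondConfig V) (d : Decidable (ω ∈ {ω : BondConfig V | P fun y z => (openGraph ω).Reachable y z})),
        @ite ℝ (ω ∈ {ω : BondConfig V | P fun y z => (openGraph ω).Reachable y z}) d 1 0 = g ω := by
      intro ω d
      by_cases hPω : P fun y z => (openGraph ω).Reachable y z
      · rw [if_pos (show ω ∈ {ω : BondConfig V | P fun y z => (openGraph ω).Reachable y z} from hPω)]; simp [hg, hPω]
      · rw [if_neg (show ω ∉ {ω : BondConfig V | P fun y z => (openGraph ω).Reachable y z} from hPω)]; simp [hg, hPω]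
    refine (Finset.sum_congr rfl fun ω _ => by rw [hgdef]).trans (Eq.trans ?_ (Finset.sum_congr rfl fun ω _ => by rw [hgdef]))
    -- Step A: on configurations of nonzero `w`-weight, `s(u,v)` is open and the transfer does not change `g`
    have hA : ∑ ω, weight wR ω * g ω = ∑ ω, weight wR ω *
        g (l.foldl (fun ω x => (if s(v, x) ∈ ω then insert s(u, x) ω else ω) \ {s(v, x)}) ω) := by
      refine sum_weight_congr fun ω hω => ?_
      have huvω : s(u, v) ∈ ω := by
        by_contra h; exact hω (weight_eq_zero_of_not_mem (by simp [hwR, h1]) h)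
      simp only [hg]
      rw [hP _ _ (fun y z _ _ => (reachable_transfer_iff u v huv l hlmem ω huvω y z).symm)]
    -- Step B: transfer of the weights
    have hB := sum_weight_transfer u v huv l wR g
    -- Step C: on configurations of nonzero `W`-weight, removing the pairs at `v` does not change `g`
    have hC : ∑ ω, weight W ω * g ω = ∑ ω, weight W ω * g (ω \ {e | e ∈ L}) := by
      refine sum_weight_congr fun ω hω => ?_
      have hleaf : ∀ x, x ≠ v → x ≠ u → s(v, x) ∉ ω := by
        intro x hxv hxu hx
        refine hω (Finset.prod_eq_zero (Finset.mem_univ s(v, x)) ?_)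
        rw [if_pos hx]; exact P4 x (hlmem' x hxu hxv)
      have hset : ω \ {e | e ∈ L} = ω \ {e | v ∈ e} := by ext e; simp [hLmem]
      simp only [hg, hset]
      rw [hP _ _ (fun y z hy hz => (reachable_removeAt_iff hleaf hy hz).symm)]
    -- Step D: zeroing the weights at `v`
    have hD := sum_weight_removeList L W g
    rw [hA, hB, hC, hD]
    refine Finset.sum_congr rfl fun ω _ => ?_
    congr 2
    funext e
    show _ = W' e
    by_cases he : e ∈ L
    · rw [if_pos he, hW']; exact (if_pos he).symm
    · rw [if_neg he, hW']; exact (if_neg he).symm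
  · -- (ii) all weights `< 1`
    intro hlt e
    show W' e < 1
    by_cases he : e ∈ L
    · simp only [hW', he, if_true]; exact zero_lt_one
    · simp only [hW', he, if_false]
      by_cases heuv : e = s(u, v)
      · exact absurd ((hLmem e).2 (heuv ▸ Sym2.mem_mk_right u v)) he
      · exact P3 (fun e' he' => hlt e' he') e heuv
  · -- (iii) live vertices
    rintro y ⟨e, hye, hpos⟩
    change 0 < W' e at hpos
    by_cases he : e ∈ L
    · simp only [hW', he, if_true] at hpos; exact absurd hpos (lt_irrefl 0)
    · simp only [hW', he, if_false] at hpos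
      have hve : v ∉ e := fun h => he ((hLmem e).2 h)
      refine ⟨fun h => hve (h ▸ hye), ?_⟩
      rcases P6 e hpos with h | ⟨x, hx, rfl, hvx⟩
      · exact ⟨e, hye, h⟩
      · -- `y ∈ s(u,x)`: `y = u` lies on `s(u,v)` (weight 1), `y = x` lies on `s(v,x)` (positive)
        rcases Sym2.mem_iff.1 hye with rfl | rfl
        · exact ⟨s(y, v), Sym2.mem_mk_left _ _, by rw [h1]; exact zero_lt_one⟩
        · exact ⟨s(v, y), Sym2.mem_mk_right _ _, hvx⟩

end Fold

end Summit.CriticalPhenomena.PercolationContinuityZ3.Theorems.EdgeContraction
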